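import Summits.QuantumAdvantage.QuantumAdvantage.Theorems.CharDialSubRank
import HarnessLib

/-!
# Junta ⊕ linear-form strategies of GROWING RANK lose α's u-walk game: the RATE DIAL (SliceDial rev 14, `LogRankHard` & co.)

decomp-qadv lens-6 («barrier-complement carving») g13, tree part 20.  Prop-free, sorry-free.  IMPORTS part 19
`CharDialSubRank.lean` (§22 `SubcubeBells.*` subcube transport, §23 the generalised block product `WindowCounter.exists_blocksG`,
`norm_sum_QfG_le`, `formSumG`, §24 `formStratRG`, `card_win_formRG_eq_sum`, `class_count_le_formRG`, `genMain`, `log_le_sq_log`,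
§25 `JLinPeel.linF_ext`, `vecF_ext`), hence parts 14/16/18 and the landed `Theorems.CharDialJLinPeel` (`JLinData`, `winCount`,
`strat_eq_formStratR`), `CharDialJLinSlice` (`sum_card_subcube`), `CharDialUnreadTwist` (`ringWinU_congr`), and the tree rungs
`AffBells22SubcubeWalk` / `AffBells22WalkHardAllSubcube` (`subcubeMerge`, `card_filter_merge_le`, `Subcube.*`), `PredHard`
(`DWalk.const_mul_logPow_le'`).

WHAT IS NEW (the node's §27).  Part 19 proved that junta ⊕ form data of every FIXED rank `r` lose (`rankLe_hard_unif`), with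
thresholds compounding like `2^{O(2^r)}` (density `1/2`, free dimension halved per sparse step), i.e. rank growing like
`log log n` at best.  Here the same engine is run with a DENSITY PARAMETER `λ` and an ADDITIVE subcube budget, and every
threshold is EXPLICIT:
* `WindowCounter.formJunta_blocksG` — the class-conditioned block product for generalised bells with density `1/λ` and block
  target `q`: `(144q+16)·λ²·(m(L+1)² + n) ≤ n²`, `n ≤ λ·#supp a`, `t ≠ 0` ⟹ `‖Σ_u [WIN u] ψ_p(t⟨a,u⟩)‖ ≤ κ_F(p)^q·2ⁿ`;
* `WindowCounter.form_reductionRGD` — the generalised `r`-form-dial reduction under ONE explicit threshold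
  `E_K·(r+1)·λ²·(log₂ N)⁴ ≤ N` (`q = q₁(r+1)` blocks push the error below `ε/p^r`);
* `JLinPeel.subRank_denseD` / `subRank_hardD` — the subcube rank induction with density `1/(2(R+1))` and budget
  `2(R+1)|W| + r·n ≤ R·n` (a sparse step costs `< N/(2(R+1))` coordinates, so the free cube never drops below `n/2` and the
  induction runs AT FIXED `n`): rank `≤ R` loses as soon as `E·(R+1)³·(log₂ n)⁴ ≤ n` — ONE `θ`, `E`, `n₀` FOR ALL `R`;
* `JLinPeel.rankRate_hard` (tables) / **`rankRate_hard_unif`** (data: `∃ θ < 1, ∃ E n₀, ∀ n ≥ n₀, ∀ R, E(R+1)³(log₂ n)⁴ ≤ n →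
  every `D : JLinData p n` with `log₂ n`-juntas and forms in the span of ANY `R` directions wins on `≤ θ·2ⁿ`);
* **`rankFn_hard`**: every ADMISSIBLE rate function `ρ` (`∀ E, eventually E(ρ n + 1)³(log₂ n)⁴ ≤ n`) is a theorem;
  `polylog_rate_admissible` (every `(log₂ n)^d`), `cubeRate` / `cubeRate_spec` / `le_cubeRate` / `cubeRate_admissible`
  (`ρ_cube(n)` = the largest `ρ ≤ n` with `ρ³(log₂ n)⁵ ≤ n`, `≈ (n / log₂⁵ n)^{1/3}`); hence **`logRank_hard`** (rank `≤ log₂ n`: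
  the node's `LogRankHard p`, the g13 target), **`polylogRank_hard d`** (rank `≤ (log₂ n)^d`), **`cubeRank_hard`** (rank `≤ ρ_cube(n)`).
In the node (`Theses.SliceDial` rev 14) these read `LogRankHard p`, `RankFnHard p (fun n => (Nat.log 2 n)^d)`, `RankFnHard p cubeRate`
for every prime `p ≥ 5`, so item 32604 at `p` is equivalent to `RankFnGtHard p cubeRate`: hardness for data of rank ABOVE
`(n/log⁵ n)^{1/3}` only — the honest ceiling of the slicing engine (the block product loses quadratically in the density).
-/

noncomputable section

open Finset
open Summit.QuantumAdvantage.AdviceFreeQNC0 Summit.QuantumAdvantage.AdviceFreeQNC0.JLinPeel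

/-! # §27 THE RATE DIAL (decomp-qadv lens-6 g13): the density-`λ` block product with EXPLICIT thresholds, and
junta ⊕ form data of GROWING rank `R(n)` with `R³·(log₂ n)⁴ = O(n)` lose — one `θ` for all ranks

§23's `formJunta_smallG` used density `1/2` and hid the block count in an `∃ Q`; §25's induction halved the free dimension per
sparse step (`K ↦ 2K`), so the thresholds compounded to `2^{O(2^r)}` and the proof reached only rate `O(log log n)`.  Here:
* `formJunta_blocksG` — the SAME block product with density `1/λ` and an explicit block target `q`: under
  `(144q+16)·λ²·(m(L+1)² + n) ≤ n²` the form-twisted bias is `≤ κ_F(p)^q·2ⁿ` (density enters only through the number of usable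
  block starts, `n ≤ 6λ·#T`);
* `form_reductionRGD` — the generalised `r`-form-dial reduction with ONE EXPLICIT threshold `E_K·(r+1)·λ²·(log₂ N)⁴ ≤ N`
  (`q = q₁(r+1)` blocks make the error `≤ ε/p^r`; `E_K` depends on `p` and the bell budget `K` only);
* `subRank_denseD` / `subRank_hardD` — the subcube rank induction with density threshold `1/λ`, `λ = 2(R+1)`, and the ADDITIVE
  budget `2(R+1)|W| + r·n ≤ R·n` (a sparse step costs `< N/λ` coordinates, so `|W| < n/2` throughout and the free cube never drops
  below half): junta ⊕ form data of rank `≤ R` lose as soon as `E·(R+1)³·(log₂ n)⁴ ≤ n`, ONE `θ` FOR ALL `R`;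
* corollaries: `rankRate_hard(_unif)` (tables / data level), `rankFn_hard` (every ADMISSIBLE rate function `ρ`:
  `∀ E, eventually E(ρ n+1)³(log₂ n)⁴ ≤ n`), `polylog_rate_admissible` (every `(log₂ n)^d`), `cubeRate_admissible`
  (`ρ_cube(n)` = the largest `ρ` with `ρ³(log₂ n)⁵ ≤ n`, i.e. `≈ (n/log⁵ n)^{1/3}`), `logRank_hard`, `polylogRank_hard`, `cubeRank_hard`. -/

namespace Summit.QuantumAdvantage.AdviceFreeQNC0.WindowCounter

open Summit.QuantumAdvantage.AdviceFreeQNC0 AffBells23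

section FormJuntaGD

variable (p : ℕ) [Fact p.Prime]

/-- **EXPLICIT FORM-TWISTED BIAS OF JUNTA STRATEGIES, DENSITY `1/λ`** (p ≥ 5): `m` generalised bells, `L`-junta tables,
a direction `a` with `n ≤ λ·#supp a`, `t ≠ 0` and `(144q+16)·λ²·(m(L+1)² + n) ≤ n²` ⟹ `‖Σ_u [WIN u] ψ_p(t⟨a,u⟩)‖ ≤ κ_F(p)^q·2ⁿ`. -/
theorem formJunta_blocksG (hp : 5 ≤ p) (q lam : ℕ) {n m L : ℕ} (pat κ : Fin m → ℕ)
    (a : Fin n → ZMod p) (y : Fin m → (Fin n → Bool) → Bool)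
    (hy : ∀ b, ∃ J : Finset (Fin n), J.card ≤ L ∧ ∀ u v : Fin n → Bool, (∀ i ∈ J, u i = v i) → y b u = y b v)
    (hQ : (144 * q + 16) * lam ^ 2 * (m * (L + 1) ^ 2 + n) ≤ n ^ 2) (hlam : 1 ≤ lam) (hn : 0 < n)
    (hdense : n ≤ lam * (univ.filter fun i : Fin n => a i ≠ 0).card) (t : ZMod p) (ht : t ≠ 0) :
    ‖formSumG p pat κ a y t‖ ≤ kappaF p ^ q * 2 ^ n := by
  classical
  have hκ0 := kappaF_nonneg p
  have hκ1 := kappaF_lt_one p hp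
  -- size consequences of the threshold
  have h16a : 16 * lam ^ 2 * n ≤ n ^ 2 :=
    le_trans (Nat.mul_le_mul (Nat.mul_le_mul_right _ (by omega)) (Nat.le_add_left n _)) hQ
  have h16 : 16 * lam ^ 2 ≤ n := Nat.le_of_mul_le_mul_right (h16a.trans (sq n).le) hn
  have hll : lam ≤ lam ^ 2 := Nat.le_self_pow two_ne_zero lam
  have hlam8 : 8 * lam ≤ n := by linarith
  have hn8 : 8 ≤ n := by omega
  choose J hJc hJ using hy
  -- candidate starts: good positions with room for a block
  set S₀ : Finset ℕ := (range n).filter fun k => k + 3 ≤ n ∧ aExt p a k ≠ 0 with hS₀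
  have hS₀card : (univ.filter fun i : Fin n => a i ≠ 0).card ≤ S₀.card + 2 := by
    have h1 : ((univ.filter fun i : Fin n => a i ≠ 0 ∧ i.val + 3 ≤ n).image fun i : Fin n => i.val) ⊆ S₀ := by
      intro k hk; rw [mem_image] at hk; obtain ⟨i, hi, rfl⟩ := hk; rw [mem_filter] at hi
      rw [hS₀, mem_filter, mem_range]; refine ⟨i.isLt, hi.2.2, ?_⟩
      unfold aExt; rw [dif_pos i.isLt]; exact hi.2.1
    have h2 : (univ.filter fun i : Fin n => ¬ (i.val + 3 ≤ n)).card ≤ 2 := by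
      calc _ ≤ (range 2).card := Finset.card_le_card_of_injOn (fun i : Fin n => n - 1 - i.val) (fun i hi => by
              have hi' : ¬ (i.val + 3 ≤ n) := by simpa using hi
              simp only [mem_coe, mem_range]; omega) (by
              intro i hi i' hi' hh
              have h3 : ¬ (i.val + 3 ≤ n) := by simpa using hi
              have h4 : ¬ (i'.val + 3 ≤ n) := by simpa using hi'
              ext; simp only at hh; omega)
        _ = 2 := card_range 2
    have h3 := card_le_card h1
    rw [card_image_of_injective _ Fin.val_injective] at h3
    calc (univ.filter fun i : Fin n => a i ≠ 0).card
        ≤ ((univ.filter fun i : Fin n => a i ≠ 0 ∧ i.val + 3 ≤ n) ∪ (univ.filter fun i : Fin n => ¬ (i.val + 3 ≤ n))).card :=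
          card_le_card (by
            intro i hi; rw [mem_filter] at hi; rw [mem_union, mem_filter, mem_filter]
            by_cases h : i.val + 3 ≤ n
            · exact Or.inl ⟨hi.1, hi.2, h⟩
            · exact Or.inr ⟨hi.1, h⟩)
      _ ≤ _ := card_union_le _ _
      _ ≤ S₀.card + 2 := add_le_add h3 h2
  obtain ⟨r, -, hr⟩ := Finset.exists_le_card_fiber_of_mul_le_card_of_maps_to (s := S₀) (t := range 3) (f := fun k => k % 3)
    (fun k _ => mem_range.2 (Nat.mod_lt _ (by norm_num))) (by simp) (by rw [card_range]; exact Nat.mul_div_le _ 3)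
  set T := S₀.filter fun k => k % 3 = r with hTdef
  have hT3 : S₀.card ≤ 3 * T.card + 2 := by have := hr; omega
  have hTn : ∀ k ∈ T, k + 3 ≤ n := fun k hk => by
    have := (mem_filter.1 (mem_filter.1 hk).1).2; exact this.1
  have hTgd : ∀ k ∈ T, aExt p a k ≠ 0 := fun k hk => by
    have := (mem_filter.1 (mem_filter.1 hk).1).2; exact this.2
  have hTsep : ∀ k ∈ T, ∀ k' ∈ T, k ≠ k' → k + 3 ≤ k' ∨ k' + 3 ≤ k := fun k hk k' hk' hne => by
    have h1 := (mem_filter.1 hk).2; have h2 := (mem_filter.1 hk').2; omega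
  have hTle : T.card ≤ n :=
    (card_le_card (filter_subset _ _)).trans ((card_le_card (filter_subset _ _)).trans (card_range n).le)
  obtain ⟨M, k, hkT, hkinj, hni, hsize⟩ := exists_blocksG pat J hJc T hTsep
  -- enough blocks: `q ≤ M`
  have hM : q ≤ M := by
    by_contra hlt; push Not at hlt
    have hd' : n ≤ lam * (3 * T.card + 4) := hdense.trans (Nat.mul_le_mul_left _ (by omega))
    have h12 : n ≤ 6 * (lam * T.card) := by linarith
    have hsz : T.card ^ 2 ≤ 2 * q * (2 * (m * (L + 1) ^ 2) + T.card) :=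
      le_trans hsize (Nat.mul_le_mul_right _ (Nat.mul_le_mul_left _ hlt.le))
    have hchain : n ^ 2 ≤ 144 * q * lam ^ 2 * (m * (L + 1) ^ 2 + n) :=
      calc n ^ 2 ≤ (6 * (lam * T.card)) ^ 2 := Nat.pow_le_pow_left h12 2
        _ = 36 * lam ^ 2 * T.card ^ 2 := by ring
        _ ≤ 36 * lam ^ 2 * (2 * q * (2 * (m * (L + 1) ^ 2) + T.card)) := Nat.mul_le_mul_left _ hsz
        _ ≤ 36 * lam ^ 2 * (2 * q * (2 * (m * (L + 1) ^ 2) + 2 * n)) :=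
            Nat.mul_le_mul_left _ (Nat.mul_le_mul_left _ (by linarith))
        _ = 144 * q * lam ^ 2 * (m * (L + 1) ^ 2 + n) := by ring
    have h7 : 8 ≤ lam ^ 2 * (m * (L + 1) ^ 2 + n) :=
      calc 8 = 1 * 8 := by norm_num
        _ ≤ lam ^ 2 * (m * (L + 1) ^ 2 + n) := Nat.mul_le_mul (Nat.one_le_pow _ _ hlam) (le_add_left hn8)
    have hsplit : (144 * q + 16) * lam ^ 2 * (m * (L + 1) ^ 2 + n) =
        144 * q * lam ^ 2 * (m * (L + 1) ^ 2 + n) + 16 * (lam ^ 2 * (m * (L + 1) ^ 2 + n)) := by ring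
    omega
  -- the two character sums
  have hkn : ∀ j, k j + 3 ≤ n := fun j => hTn _ (hkT j)
  have hksep : ∀ j j', j ≠ j' → k j + 3 ≤ k j' ∨ k j' + 3 ≤ k j := fun j j' h => hTsep _ (hkT j) _ (hkT j') (hkinj j j' h)
  have hkgd : ∀ j, aExt p a (k j) ≠ 0 := fun j => hTgd _ (hkT j)
  have hQ1 := norm_sum_QfG_le p pat κ y J hp hJ a ht M k hkn hksep hni hkgd
  have hQ0 := norm_sum_QfG_le p pat κ (fun _ _ => false) J hp (fun _ _ _ _ => rfl) a ht M k hkn hksep hni hkgd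
  have hplain : ∑ u, QfG p pat κ (fun _ _ => false) a t u = ∑ u : Fin n → Bool, (ZMod.stdAddChar (t * linF p a u) : ℂ) :=
    sum_congr rfl fun u _ => by simp [QfG, firesG]
  rw [hplain] at hQ0
  have e : ∀ u : Fin n → Bool, (if ringWinGen pat κ y u = true then (1 : ℂ) else 0) * (ZMod.stdAddChar (t * linF p a u) : ℂ) =
      ((ZMod.stdAddChar (t * linF p a u) : ℂ) - QfG p pat κ y a t u) / 2 := fun u => by
    rw [win_indicatorG]; unfold QfG; ring
  have hform : formSumG p pat κ a y t =
      ((∑ u : Fin n → Bool, (ZMod.stdAddChar (t * linF p a u) : ℂ)) - ∑ u, QfG p pat κ y a t u) / 2 := by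
    unfold formSumG; rw [sum_congr rfl fun u _ => e u, ← sum_div, sum_sub_distrib]
  have hκM : kappaF p ^ M ≤ kappaF p ^ q := pow_le_pow_of_le_one hκ0 hκ1.le hM
  have h2 : ‖(2 : ℂ)‖ = 2 := by simp
  have h2n : (0 : ℝ) ≤ 2 ^ n := by positivity
  rw [hform, norm_div, h2]
  calc _ ≤ (‖∑ u : Fin n → Bool, (ZMod.stdAddChar (t * linF p a u) : ℂ)‖ + ‖∑ u, QfG p pat κ y a t u‖) / 2 := by
        gcongr; exact norm_sub_le _ _
    _ ≤ (2 ^ n * kappaF p ^ M + 2 ^ n * kappaF p ^ M) / 2 := by gcongr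
    _ = 2 ^ n * kappaF p ^ M := by ring
    _ ≤ 2 ^ n * kappaF p ^ q := mul_le_mul_of_nonneg_left hκM h2n
    _ = kappaF p ^ q * 2 ^ n := mul_comm _ _

end FormJuntaGD

section SpreadFormGD

variable (p : ℕ) [Fact p.Prime]

/-- **EXPLICIT GENERALISED `r`-FORM-DIAL REDUCTION, DENSITY `1/λ` — ONE THRESHOLD FOR EVERY RANK AND DENSITY**: for `p ≥ 5`
there is `θ₁ < 1`, and for every bell budget `K` constants `E`, `N₀` such that: `N ≥ N₀`, `E·(r+1)·λ²·(log₂ N)⁴ ≤ N`, `m ≤ K·N`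
bells, an `r`-form dial of `(log₂ N)²`-junta class strategies whose every nonzero combination has `≥ N/λ` nonzero coefficients
⟹ `#WIN^{gen} ≤ θ₁·2^N`. -/
theorem form_reductionRGD (hp : 5 ≤ p) : ∃ θ₁ : ℝ, θ₁ < 1 ∧ ∀ K : ℕ, ∃ E N₀ : ℕ, ∀ N ≥ N₀, ∀ r lam : ℕ,
    E * (r + 1) * lam ^ 2 * (Nat.log 2 N) ^ 4 ≤ N → ∀ m ≤ K * N,
    ∀ (pat κ : Fin m → ℕ) (A : Fin r → Fin N → ZMod p) (Y : (Fin r → ZMod p) → Fin m → (Fin N → Bool) → Bool),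
      (∀ t : Fin r → ZMod p, t ≠ 0 → N ≤ lam * (univ.filter fun i : Fin N => comb p t A i ≠ 0).card) →
      (∀ s b, ∃ J : Finset (Fin N), J.card ≤ (Nat.log 2 N) ^ 2 ∧ ∀ u v : Fin N → Bool, (∀ i ∈ J, u i = v i) →
        Y s b u = Y s b v) →
        (#{u : Fin N → Bool | ringWinGen pat κ (formStratRG p A Y) u = true} : ℝ) ≤ θ₁ * 2 ^ N := by
  obtain ⟨θ₀, hθ₀, N₀, hN₀⟩ := genMain
  have hp0 : (0 : ℝ) < p := by exact_mod_cast (Fact.out : p.Prime).pos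
  have hκ0 := kappaF_nonneg p
  have hκ1 := kappaF_lt_one p hp
  set ε : ℝ := (1 - θ₀) / 2 with hε
  have hε0 : 0 < ε := by rw [hε]; linarith
  obtain ⟨qa, hqa⟩ := exists_pow_lt_of_lt_one hε0 hκ1
  obtain ⟨qb, hqb⟩ := exists_pow_lt_of_lt_one (inv_pos.2 hp0) hκ1
  obtain ⟨q₁, hqa₁, hqb₁⟩ : ∃ q₁ : ℕ, qa ≤ q₁ ∧ qb ≤ q₁ := ⟨max qa qb, le_max_left _ _, le_max_right _ _⟩
  have hk1 : kappaF p ^ q₁ ≤ ε := (pow_le_pow_of_le_one hκ0 hκ1.le hqa₁).trans hqa.le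
  have hk2 : kappaF p ^ q₁ ≤ (p : ℝ)⁻¹ := (pow_le_pow_of_le_one hκ0 hκ1.le hqb₁).trans hqb.le
  refine ⟨θ₀ + ε, by rw [hε]; linarith, fun K => ⟨(144 * q₁ + 16) * (4 * K + 1), max N₀ 2,
    fun N hN r lam hE m hm pat κ A Y hdense hY => ?_⟩⟩
  have hNN₀ : N₀ ≤ N := le_trans (le_max_left _ _) hN
  have hN2 : 2 ≤ N := le_trans (le_max_right _ _) hN
  have hN0 : 0 < N := by omega
  have hpr : (0 : ℝ) < (p : ℝ) ^ r := by positivity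
  set ℓ := Nat.log 2 N with hℓdef
  have hℓ : 1 ≤ ℓ := Nat.le_log_of_pow_le one_lt_two (by rw [pow_one]; exact hN2)
  have hℓ4 : 1 ≤ ℓ ^ 4 := Nat.one_le_pow _ _ hℓ
  have hL1 : (ℓ ^ 2 + 1) ^ 2 ≤ 4 * ℓ ^ 4 := by nlinarith [hℓ]
  -- the explicit block target `q = q₁·(r+1)`: error `κ^q ≤ ε/p^r`
  set q := q₁ * (r + 1) with hqdef
  have hκq : kappaF p ^ q ≤ ε / (p : ℝ) ^ r := by
    rw [hqdef, pow_mul, pow_succ', div_eq_mul_inv, ← inv_pow]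
    exact mul_le_mul hk1 (pow_le_pow_left₀ (pow_nonneg hκ0 _) hk2 r) (pow_nonneg (pow_nonneg hκ0 _) _) hε0.le
  have hQ : (144 * q + 16) * lam ^ 2 * (m * (ℓ ^ 2 + 1) ^ 2 + N) ≤ N ^ 2 := by
    have h1 : 144 * q + 16 ≤ (144 * q₁ + 16) * (r + 1) :=
      calc 144 * q + 16 ≤ 144 * (q₁ * (r + 1)) + 16 * (r + 1) :=
            Nat.add_le_add_left (Nat.le_mul_of_pos_right _ (Nat.succ_pos r)) _
        _ = (144 * q₁ + 16) * (r + 1) := by ring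
    have h2 : m * (ℓ ^ 2 + 1) ^ 2 + N ≤ (4 * K + 1) * ℓ ^ 4 * N :=
      calc m * (ℓ ^ 2 + 1) ^ 2 + N ≤ K * N * (4 * ℓ ^ 4) + N * ℓ ^ 4 :=
            add_le_add (Nat.mul_le_mul hm hL1) (by
              calc N = N * 1 := (mul_one _).symm
                _ ≤ N * ℓ ^ 4 := Nat.mul_le_mul_left _ hℓ4)
        _ = (4 * K + 1) * ℓ ^ 4 * N := by ring
    calc (144 * q + 16) * lam ^ 2 * (m * (ℓ ^ 2 + 1) ^ 2 + N)
        ≤ (144 * q₁ + 16) * (r + 1) * lam ^ 2 * ((4 * K + 1) * ℓ ^ 4 * N) :=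
          Nat.mul_le_mul (Nat.mul_le_mul_right _ h1) h2
      _ = (144 * q₁ + 16) * (4 * K + 1) * (r + 1) * lam ^ 2 * ℓ ^ 4 * N := by ring
      _ ≤ N * N := Nat.mul_le_mul_right _ hE
      _ = N ^ 2 := (sq N).symm
  have hlam : ∀ t : Fin r → ZMod p, t ≠ 0 → 1 ≤ lam := fun t ht => Nat.one_le_iff_ne_zero.2 fun h0 => by
    have := hdense t ht; rw [h0, zero_mul] at this; omega
  have hcardT : ((univ.erase (0 : Fin r → ZMod p)).card : ℝ) ≤ (p : ℝ) ^ r := by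
    have : (univ.erase (0 : Fin r → ZMod p)).card ≤ p ^ r :=
      le_trans (card_erase_le) (by rw [card_univ, Fintype.card_fun, ZMod.card, Fintype.card_fin])
    exact_mod_cast this
  have hcls : ∀ s : Fin r → ZMod p,
      (p : ℝ) ^ r * #{u : Fin N → Bool | ringWinGen pat κ (Y s) u = true ∧ vecF p A u = s} ≤ θ₀ * 2 ^ N + ε * 2 ^ N := by
    intro s
    refine le_trans (class_count_le_formRG p pat κ A (Y s) s) (add_le_add (hN₀ N hNN₀ m pat κ _ (hY s)) ?_)
    calc ∑ t ∈ univ.erase (0 : Fin r → ZMod p), ‖formSumG p pat κ (comb p t A) (Y s) 1‖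
        ≤ ∑ t ∈ univ.erase (0 : Fin r → ZMod p), ε / p ^ r * 2 ^ N :=
          sum_le_sum fun t ht => (formJunta_blocksG p hp q lam pat κ (comb p t A) (Y s) (hY s) hQ
            (hlam t (ne_of_mem_erase ht)) hN0 (hdense t (ne_of_mem_erase ht)) 1 one_ne_zero).trans
            (mul_le_mul_of_nonneg_right hκq (by positivity))
      _ ≤ (p : ℝ) ^ r * (ε / p ^ r * 2 ^ N) := by
          rw [sum_const, nsmul_eq_mul]
          exact mul_le_mul_of_nonneg_right hcardT (by positivity)
      _ = ε * 2 ^ N := by field_simp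
  have hsum : (p : ℝ) ^ r * #{u : Fin N → Bool | ringWinGen pat κ (formStratRG p A Y) u = true} ≤
      (p : ℝ) ^ r * (θ₀ * 2 ^ N + ε * 2 ^ N) := by
    rw [card_win_formRG_eq_sum p pat κ A Y]
    push_cast
    rw [mul_sum]
    calc _ ≤ ∑ s : Fin r → ZMod p, (θ₀ * 2 ^ N + ε * 2 ^ N) := sum_le_sum fun s _ => hcls s
      _ = (p : ℝ) ^ r * (θ₀ * 2 ^ N + ε * 2 ^ N) := by
          rw [sum_const, card_univ, Fintype.card_fun, ZMod.card, Fintype.card_fin, nsmul_eq_mul]; push_cast; ring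
  have := le_of_mul_le_mul_left hsum hpr
  linarith

end SpreadFormGD

end Summit.QuantumAdvantage.AdviceFreeQNC0.WindowCounter


namespace Summit.QuantumAdvantage.AdviceFreeQNC0.JLinPeel

open AffBells22 AffBells23 Subcube

section SubRankD

variable (p : ℕ) [Fact p.Prime] {n : ℕ}


end SubRankD
end Summit.QuantumAdvantage.AdviceFreeQNC0.JLinPeel
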